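import Literature.MathematicalPhysics.QuantumFieldTheory.Balaban1983to89.B8Prop3MultiLevelTorus
import Mathlib.Topology.Algebra.Module.FiniteDimension
import HarnessLib

/-!
# Route `UnitScaleTilt`, crux K1 «MinimiserStabilityRegPr» (stmt-QuantumFields-19200), stub V2′ `stub_halvingStep`, C_E node after RULING g26-№6 —
# (S4′) THE TUBE LETTERS OF THE (149)–(155) TOWER ON THE TORUS: the one-step straight-line tube `L·Q` of [Balaban1984PropagatorsI] (1.11) has
# (t) reader mass `≤ 2·L·L^{−d}` on the level readers of a fine bond, (α) composed kernel `‖(Lᵐ·Q_m e_bM)(c)‖ ≤ Lᵐ·L^{−md}·‖M‖`, (loc) support in the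
# readers, (ν) at most `2d` readers per level; + the tube as a continuous ℂ-linear map (for the chain rule of `ChartKernelTower.tower_deriv_recursion`)

Cell `ym3-torus` (HUMAN RULING D-0037: YM₃ on the torus is ladder rung R3, not the Clay problem), width seat `ym-ust-19936-w5` gen 3; `--supports stmt-QuantumFields-19200
--as helper`; def-free, 0 sorry.  ★★OWNER ACK 20 (a): «(S4′) GO».

WHY.  ✓`ChartKernelTower.kernel_tower_bound` (p610533) reduces print's per-bond kernel row (157) for the double-bar chart `chartLogFlat` (✓`Prop8ChartDoubleBar`, (S1)) to
per-level letters.  The LINEAR ones concern only the straight-line tube `T = L·Q`, `Q = LatticeFieldCalculus.bondAvg` — which IS the linearisation of the double-bar one step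
(✓`linAvg_eq_bondAvg_sub_grad_combMean`: the frames remove the comb gradient) — and are supplied here, generically in the `Params` and in the value space:
* §1 `norm_bondAvg_le_bondAvg_norm` (`‖(QY)(c)‖ ≤ (Q‖Y‖)(c)`), `bondAvg_smul_const`∕`bondAvgIter_smul_const` (`Q_m(X•M) = (Q_mX)•M`), `bondAvg_single_le_mass`∕
  `bondAvgIter_single_le_mass` (`Q_m(c,b) ≤ L^{−md}` from the column mass ✓`sum_bondAvgIter_single` and positivity), `bondAvg_single_eq_zero_of_dir_ne`;
* §2 (α) `norm_iterTube_single_le`: `‖Lᵐ·(Q_m e_bM)(c)‖ ≤ Lᵐ·L^{−md}·‖M‖` — the letter `ha` of the tower (`α_m = η·L^{m(1−d)}‖M‖`, `λ = L^{1−d}`);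
  (loc) `iterTube_single_eq_zero_of_not_reads`: it vanishes unless `c` READS `b` (both `Bᵐ`-blocks of the endpoints of `b` among `{c₋, c₊}`; ✓`bondAvgIter_eq_zero_of_local`);
* §3 (ν) `card_filter_endpoint_dir_le_two`, `card_le_two_mul_d_of_endpoint`: at most 2 level-`m` bonds of a given direction, and at most `2d` in all, share a given endpoint
  (the readers of a fine bond do); `card_run_fibre_le` (a bond lies on at most `L` feeding contours); (t) `norm_tube_le_of_vanish` ∕ `norm_tube_le_of_endpoint`: for `w` vanishing off a finite set `S` with `‖w‖ ≤ β` on `S`, `‖L·(Qw)(c)‖ ≤ L·L^{−d}·#{c′ ∈ S : dir c′ = dir c}·β` — so on the readers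
  of a fine bond `θ₀ = 2·L^{1−d}` and the tower's contraction is `θ = θ₀/(L·λ) = 2/L` (`< 1` for the cell's odd `L ≥ 3`; print's sharper `(2L−1)/L²` is not needed);
* §4 `exists_tubeCLM`: `L·Q` as a continuous ℂ-linear map on fields with values in a finite-dimensional complex normed space.
HONEST SCOPE.  Lattice bookkeeping for the tower's LINEAR hypotheses (`hT`, `ha`, `hSa`, `hcard`); the analytic ones (one-step (148)♭, differentiability, the geometric cone
sizes) wait for (S3)'s C⁰ letter of the double-bar one step.  NOT a claim about the stub, the crux, the rung or the mass gap.

References: T. Bałaban, CMP **95** (1984) 17–40 [Balaban1984PropagatorsI] ((1.11) p.19, (1.18) p.20); CMP **98** (1985) 17–51 [Balaban1985Averaging] ((140)–(142) p.39,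
(147) p.40, (153)–(154) p.41).
-/

noncomputable section

open scoped BigOperators

namespace Summit.QuantumFields.YangMills.Theorems.ChartKernelTube

open Literature.MathematicalPhysics.QuantumFieldTheory.Balaban1983to89
open LatticeFieldCalculus (bondAvg bondAvgIter segSum runBond runSite)
open B5Eq118OneStroke (iterBlockOf)
open B6GOmegaMarginV1 (bondAvgIter_eq_zero_of_local)
open B8Prop3MultiLevelTorus (sum_bondAvgIter_single bondAvgIter_single_nonneg bondAvgIter_nonneg)

variable {P : Params}

/-! ## §1 Positivity, scalars, column mass of the straight-line average -/

section Basic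

variable {j : ℕ} {V : Type*} [NormedAddCommGroup V] [NormedSpace ℝ V]

/-- **`‖(QY)(c)‖ ≤ (Q‖Y‖)(c)`**: the block average (1.11) is a convex combination of straight-contour sums (triangle inequality termwise).
[cite: Balaban1984PropagatorsI, (1.11) p.19] -/
theorem norm_bondAvg_le_bondAvg_norm (Y : VecField P j V) (c : PBond P (j + 1)) :
    ‖bondAvg Y c‖ ≤ bondAvg (fun b => ‖Y b‖) c := by
  unfold bondAvg segSum
  have hL0 : (0 : ℝ) ≤ ((P.L : ℝ) ^ (P.d + 1))⁻¹ := by positivity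
  rw [norm_smul, Real.norm_of_nonneg hL0, smul_eq_mul]
  refine mul_le_mul_of_nonneg_left ?_ hL0
  refine (norm_sum_le _ _).trans (Finset.sum_le_sum fun r _ => norm_sum_le _ _)

/-- `Q(X•M) = (QX)•M` for a real field `X` and a fixed vector `M` (linearity of (1.11)). [cite: Balaban1984PropagatorsI, (1.11) p.19] -/
theorem bondAvg_smul_const (X : VecField P j ℝ) (M : V) (c : PBond P (j + 1)) :
    bondAvg (fun b => X b • M) c = bondAvg X c • M := by
  unfold bondAvg segSum
  rw [smul_eq_mul, mul_smul, Finset.sum_smul]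
  congr 1
  exact Finset.sum_congr rfl fun r _ => by rw [Finset.sum_smul]

/-- `Q_m(X•M) = (Q_mX)•M` (iterate of `bondAvg_smul_const`). [cite: Balaban1984PropagatorsI, (1.18) p.20] -/
theorem bondAvgIter_smul_const (M : V) : ∀ (m : ℕ) (X : VecField P 0 ℝ) (c : PBond P m),
    bondAvgIter m (fun b => X b • M) c = bondAvgIter m X c • M
  | 0, X, c => rfl
  | m + 1, X, c => by
    show bondAvg (bondAvgIter m (fun b => X b • M)) c = bondAvg (bondAvgIter m X) c • M
    rw [show bondAvgIter m (fun b => X b • M) = fun c' => bondAvgIter m X c' • M from funext (bondAvgIter_smul_const M m X),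
      bondAvg_smul_const]

open Classical in
/-- A unit column of `Q` is bounded by its column mass: `Q(c, b) ≤ L^{−d}` (✓`sum_bondAvg_single`, positivity; standing range). [cite: Balaban1984PropagatorsI, (1.11) p.19] -/
theorem bondAvg_single_le_mass (hj : j + 1 ≤ P.m + P.K) (b : PBond P j) (c : PBond P (j + 1)) :
    bondAvg (Pi.single b (1 : ℝ)) c ≤ ((P.L : ℝ) ^ P.d)⁻¹ := by
  classical
  have hnn : ∀ c' : PBond P (j + 1), 0 ≤ bondAvg (Pi.single b (1 : ℝ)) c' := fun c' =>
    B6QppKernelV1.bondAvg_nonneg (fun b' => by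
      by_cases h : b' = b
      · subst h; simp
      · simp [Pi.single_eq_of_ne h]) c'
  have h := Finset.single_le_sum (f := fun c' => bondAvg (Pi.single b (1 : ℝ)) c') (fun c' _ => hnn c') (Finset.mem_univ c)
  have hsum := B6QppKernelV1.sum_bondAvg_single hj b
  convert h.trans hsum.le using 2

open Classical in
/-- A unit column of `Q_m` is bounded by its column mass: `Q_m(c, b) ≤ (L^{−d})ᵐ` (✓`sum_bondAvgIter_single`, ✓`bondAvgIter_single_nonneg`; standing range).
[cite: Balaban1984PropagatorsI, (1.18) p.20] -/
theorem bondAvgIter_single_le_mass {m : ℕ} (hm : m ≤ P.m + P.K) (b : PBond P 0) (c : PBond P m) :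
    bondAvgIter m (Pi.single b (1 : ℝ)) c ≤ (((P.L : ℝ) ^ P.d)⁻¹) ^ m := by
  classical
  have h := Finset.single_le_sum (f := fun c' => bondAvgIter m (Pi.single b (1 : ℝ)) c') (fun c' _ => bondAvgIter_single_nonneg m b c')
    (Finset.mem_univ c)
  have hsum := sum_bondAvgIter_single (P := P) hm b
  convert h.trans hsum.le using 2

open Classical in
/-- The straight contours feeding `(QY)(c)` consist of bonds of direction `dir c`: a unit column in another direction is invisible. [cite: Balaban1984PropagatorsI, (1.11) p.19] -/
theorem bondAvg_single_eq_zero_of_dir_ne (b : PBond P j) (c : PBond P (j + 1)) (h : b.dir ≠ c.dir) :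
    bondAvg (Pi.single b (1 : ℝ)) c = 0 := by
  unfold bondAvg segSum
  rw [smul_eq_zero]
  refine Or.inr (Finset.sum_eq_zero fun r _ => Finset.sum_eq_zero fun t _ => ?_)
  have hne : runBond (Site.blockSite c.src r) c.dir t ≠ b := by
    intro hb
    apply h
    rw [← hb]
    rfl
  exact Pi.single_eq_of_ne hne _

end Basic

/-! ## §2 The composed tube on a unit direction: size (α) and support (loc) -/

section Composed

variable {V : Type*} [NormedAddCommGroup V] [NormedSpace ℝ V]

open Classical in
/-- A single-bond field as a real unit column times its value. [folklore] -/
theorem pi_single_eq_smul (b : PBond P 0) (M : V) :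
    (Pi.single b M : PBond P 0 → V) = fun b' => (Pi.single b (1 : ℝ) : PBond P 0 → ℝ) b' • M := by
  funext b'
  by_cases h : b' = b
  · subst h; simp
  · simp [Pi.single_eq_of_ne h]

open Classical in
/-- **(α) THE COMPOSED TUBE ON A UNIT DIRECTION**: `‖Lᵐ·(Q_m e_bM)(c)‖ ≤ Lᵐ·(L^{−d})ᵐ·‖M‖` — print's «|Q_k(U₀; c, b)| ≤ 1» ((147), flat background), i.e. every fine bond lies on at most
`Lᵐ` of the `L^{m(d+1)}` straight `Lᵐ`-contours of one level-`m` block, read through the column mass (standing range `m ≤ m_P + K_P`). This is the letter `ha` of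
✓`ChartKernelTower.kernel_tower_bound` with `α_m = η·Lᵐ·L^{−md}·‖M‖`, `λ = L^{1−d}`. [cite: Balaban1985Averaging, (147) p.40; Balaban1984PropagatorsI, (1.18) p.20] -/
theorem norm_iterTube_single_le {m : ℕ} (hm : m ≤ P.m + P.K) (b : PBond P 0) (M : V) (c : PBond P m) :
    ‖((P.L : ℝ) ^ m) • bondAvgIter m (Pi.single b M) c‖ ≤ (P.L : ℝ) ^ m * (((P.L : ℝ) ^ P.d)⁻¹) ^ m * ‖M‖ := by
  rw [pi_single_eq_smul b M, bondAvgIter_smul_const M m, smul_smul, norm_smul, Real.norm_eq_abs, abs_mul,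
    abs_of_nonneg (by positivity : (0 : ℝ) ≤ (P.L : ℝ) ^ m), abs_of_nonneg (bondAvgIter_single_nonneg m b c)]
  gcongr
  exact bondAvgIter_single_le_mass hm b c

open Classical in
/-- **(loc) SUPPORT OF THE COMPOSED TUBE**: `(Q_m e_bM)(c) = 0` unless `c` READS `b`, i.e. unless both `Bᵐ(b₋), Bᵐ(b₊) ∈ {c₋, c₊}` (✓`bondAvgIter_eq_zero_of_local`) — the support letter
`hSa` of the tower. [cite: Balaban1984PropagatorsI, (1.18) p.20] -/
theorem iterTube_single_eq_zero_of_not_reads {m : ℕ} (hm : m ≤ P.m + P.K) (b : PBond P 0) (M : V) (c : PBond P m)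
    (hnot : ¬ ((iterBlockOf m b.src = c.src ∨ iterBlockOf m b.src = c.tgt) ∧ (iterBlockOf m b.tgt = c.src ∨ iterBlockOf m b.tgt = c.tgt))) :
    ((P.L : ℝ) ^ m) • bondAvgIter m (Pi.single b M) c = 0 := by
  rw [pi_single_eq_smul b M, bondAvgIter_smul_const M m]
  have h0 : bondAvgIter m (Pi.single b (1 : ℝ)) c = 0 := by
    refine bondAvgIter_eq_zero_of_local m hm _ c fun b' hs ht => ?_
    by_cases hb : b' = b
    · subst hb; exact absurd ⟨hs, ht⟩ hnot
    · exact Pi.single_eq_of_ne hb _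
  rw [h0, zero_smul, smul_zero]

end Composed

/-! ## §3 Readers of a fine bond at one level: the counts (ν) and the tube mass (t) -/

section Readers

variable {j : ℕ}

/-- **AT MOST TWO READERS PER DIRECTION**: the level-`j` bonds `c′` of direction `μ` having a given site `β` among their endpoints are `⟨β, μ⟩` and `⟨β − e_μ, μ⟩`.
[cite: Balaban1985Averaging, (141)-(142) p.39] -/
theorem card_filter_endpoint_dir_le_two (β : Site P j) (μ : Fin P.d) (S : Finset (PBond P j))
    (hS : ∀ c' ∈ S, c'.src = β ∨ c'.tgt = β) :
    (S.filter fun c' => c'.dir = μ).card ≤ 2 := by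
  classical
  have hsub : (S.filter fun c' => c'.dir = μ) ⊆ ({⟨β, μ⟩, ⟨β.unshift μ, μ⟩} : Finset (PBond P j)) := by
    intro c' hc'
    rw [Finset.mem_filter] at hc'
    obtain ⟨hc'S, hdir⟩ := hc'
    rcases hS c' hc'S with h | h
    · rw [Finset.mem_insert]; left
      cases c'; simp only at hdir h; subst hdir; subst h; rfl
    · rw [Finset.mem_insert, Finset.mem_singleton]; right
      cases c' with
      | mk s d =>
        simp only at hdir; subst hdir
        have hs : s = β.unshift d := by
          have hsd : s.shift d = β := h
          have e : (s.shift d).unshift d = s := (LatticeFieldCalculus.shiftEquiv (P := P) (j := j) d).symm_apply_apply s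
          rw [← e, hsd]
        subst hs; rfl
  exact (Finset.card_le_card hsub).trans (Finset.card_le_two)

/-- **(ν) AT MOST `2d` READERS**: a finite set of level-`j` bonds all having the site `β` among their endpoints has at most `2d` elements (print's «2d» of (142)).
[cite: Balaban1985Averaging, (142) p.39] -/
theorem card_le_two_mul_d_of_endpoint (β : Site P j) (S : Finset (PBond P j)) (hS : ∀ c' ∈ S, c'.src = β ∨ c'.tgt = β) :
    S.card ≤ 2 * P.d := by
  classical
  rw [Finset.card_eq_sum_card_fiberwise (f := fun c' : PBond P j => c'.dir) (t := Finset.univ) fun _ _ => Finset.mem_univ _]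
  calc ∑ μ ∈ (Finset.univ : Finset (Fin P.d)), (S.filter fun c' => c'.dir = μ).card ≤ ∑ _μ ∈ (Finset.univ : Finset (Fin P.d)), 2 :=
        Finset.sum_le_sum fun μ _ => card_filter_endpoint_dir_le_two β μ S hS
    _ = 2 * P.d := by rw [Finset.sum_const, Finset.card_univ, Fintype.card_fin, smul_eq_mul, mul_comm]

variable {V : Type*} [NormedAddCommGroup V] [NormedSpace ℝ V]

/-- The straight contour of `(QY)(c)` through a prescribed bond: for fixed `t`, at most one offset `r` has `runBond (blockSite c₋ r) (dir c) t = c′` (`blockSite` and `x ↦ x + te_μ` are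
injective; standing range). [cite: Balaban1984PropagatorsI, (1.11) p.19] -/
theorem card_run_fibre_le (hj : j + 1 ≤ P.m + P.K) (c : PBond P (j + 1)) (c' : PBond P j) :
    ((Finset.univ ×ˢ Finset.range P.L).filter fun rt : (Fin P.d → Fin P.L) × ℕ => runBond (Site.blockSite c.src rt.1) c.dir rt.2 = c').card ≤ P.L := by
  classical
  have hinj : Set.InjOn (fun rt : (Fin P.d → Fin P.L) × ℕ => rt.2)
      ↑((Finset.univ ×ˢ Finset.range P.L).filter fun rt : (Fin P.d → Fin P.L) × ℕ => runBond (Site.blockSite c.src rt.1) c.dir rt.2 = c') := by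
    intro rt hrt rt' hrt' ht
    simp only [Finset.coe_filter, Finset.mem_product, Finset.mem_univ, Finset.mem_range, true_and, Set.mem_setOf_eq] at hrt hrt'
    have hsite : runSite (Site.blockSite c.src rt.1) c.dir rt.2 = runSite (Site.blockSite c.src rt'.1) c.dir rt'.2 := by
      have h1 := congrArg PBond.src hrt.2
      have h2 := congrArg PBond.src hrt'.2
      simp only [runBond] at h1 h2
      rw [h1, h2]
    have ht' : rt.2 = rt'.2 := ht
    rw [ht'] at hsite
    have hbs : Site.blockSite c.src rt.1 = Site.blockSite c.src rt'.1 := by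
      funext ν
      have := congrFun hsite ν
      by_cases hν : ν = c.dir
      · subst hν
        simpa [runSite, Function.update_self] using this
      · simpa [runSite, Function.update_of_ne hν] using this
    have hr : rt.1 = rt'.1 := (AveragingRT.blockSite_inj hj hbs).2
    exact Prod.ext hr ht'
  calc _ ≤ (Finset.range P.L).card := Finset.card_le_card_of_injOn (fun rt => rt.2) (fun rt hrt => by
          simp only [Finset.coe_filter, Finset.mem_product, Finset.mem_range] at hrt
          exact Finset.mem_range.mpr hrt.1.2) hinj
    _ = P.L := Finset.card_range _

/-- **(t) THE TUBE MASS ON A FINITE SET**: for `w` vanishing off `S` with `‖w‖ ≤ β` on `S`, `‖L·(Qw)(c)‖ ≤ L·L^{−d}·#{c′ ∈ S : dir c′ = dir c}·β` — each bond of `S` parallel to `c`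
lies on at most `L` of the `L^{d+1}` feeding contours, the others on none.  With ✓`card_filter_endpoint_dir_le_two` this is the letter `hT` of ✓`ChartKernelTower.kernel_tower_bound`
with `θ₀ = 2·L·L^{−d}` on the readers of a fine bond (standing range). [cite: Balaban1985Averaging, (142) p.39, (154) p.41] -/
theorem norm_tube_le_of_vanish (hj : j + 1 ≤ P.m + P.K) (S : Finset (PBond P j)) (w : VecField P j V) (hw : ∀ c', c' ∉ S → w c' = 0)
    {β : ℝ} (hβ : 0 ≤ β) (hwβ : ∀ c' ∈ S, ‖w c'‖ ≤ β) (c : PBond P (j + 1)) :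
    ‖(P.L : ℝ) • bondAvg w c‖ ≤ (P.L : ℝ) * ((P.L : ℝ) ^ P.d)⁻¹ * (S.filter fun c' => c'.dir = c.dir).card * β := by
  classical
  have hL0 : (0 : ℝ) < P.L := Nat.cast_pos.2 P.L_pos
  -- pointwise: `‖w b‖ ≤ β·𝟙[b ∈ S]`
  have hpt : ∀ b : PBond P j, ‖w b‖ ≤ if b ∈ S then β else 0 := fun b => by
    by_cases hb : b ∈ S
    · rw [if_pos hb]; exact hwβ b hb
    · rw [if_neg hb, hw b hb, norm_zero]
  -- the feeding pairs hitting `S`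
  set F : Finset ((Fin P.d → Fin P.L) × ℕ) := Finset.univ ×ˢ Finset.range P.L with hF
  set f : (Fin P.d → Fin P.L) × ℕ → PBond P j := fun rt => runBond (Site.blockSite c.src rt.1) c.dir rt.2 with hf
  have hcount : ((F.filter fun rt => f rt ∈ S).card : ℝ) ≤ P.L * (S.filter fun c' => c'.dir = c.dir).card := by
    have hfib := Finset.card_eq_sum_card_fiberwise (s := F.filter fun rt => f rt ∈ S) (t := S) (f := f) fun rt hrt => (Finset.mem_filter.mp hrt).2
    rw [hfib]
    have hterm : ∀ c' ∈ S, (((F.filter fun rt => f rt ∈ S).filter fun rt => f rt = c').card : ℝ) ≤ if c'.dir = c.dir then (P.L : ℝ) else 0 := by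
      intro c' hc'
      by_cases hd : c'.dir = c.dir
      · rw [if_pos hd]
        have hsub : ((F.filter fun rt => f rt ∈ S).filter fun rt => f rt = c') ⊆ F.filter fun rt => f rt = c' := by
          intro rt hrt
          simp only [Finset.mem_filter] at hrt ⊢
          exact ⟨hrt.1.1, hrt.2⟩
        exact_mod_cast (Finset.card_le_card hsub).trans (card_run_fibre_le hj c c')
      · rw [if_neg hd]
        have hemp : ((F.filter fun rt => f rt ∈ S).filter fun rt => f rt = c') = ∅ := by
          refine Finset.filter_eq_empty_iff.mpr fun rt _ hrt => hd ?_
          rw [← hrt]; rfl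
        rw [hemp, Finset.card_empty, Nat.cast_zero]
    push_cast
    refine (Finset.sum_le_sum hterm).trans ?_
    rw [Finset.sum_ite, Finset.sum_const_zero, add_zero, Finset.sum_const, nsmul_eq_mul, mul_comm]
  -- the average of the norms
  have havg : bondAvg (fun b => ‖w b‖) c ≤ ((P.L : ℝ) ^ (P.d + 1))⁻¹ * (β * ((F.filter fun rt => f rt ∈ S).card : ℝ)) := by
    unfold bondAvg segSum
    rw [smul_eq_mul]
    refine mul_le_mul_of_nonneg_left ?_ (by positivity)
    calc ∑ r : Fin P.d → Fin P.L, ∑ t ∈ Finset.range P.L, ‖w (runBond (Site.blockSite c.src r) c.dir t)‖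
        = ∑ rt ∈ F, ‖w (f rt)‖ := by rw [hF, Finset.sum_product]
      _ ≤ ∑ rt ∈ F, (if f rt ∈ S then β else 0) := Finset.sum_le_sum fun rt _ => hpt (f rt)
      _ = β * ((F.filter fun rt => f rt ∈ S).card : ℝ) := by
          rw [Finset.sum_ite, Finset.sum_const_zero, add_zero, Finset.sum_const, nsmul_eq_mul, mul_comm]
  -- assemble
  rw [norm_smul, Real.norm_of_nonneg hL0.le]
  calc (P.L : ℝ) * ‖bondAvg w c‖ ≤ (P.L : ℝ) * bondAvg (fun b => ‖w b‖) c :=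
        mul_le_mul_of_nonneg_left (norm_bondAvg_le_bondAvg_norm w c) hL0.le
    _ ≤ (P.L : ℝ) * (((P.L : ℝ) ^ (P.d + 1))⁻¹ * (β * ((F.filter fun rt => f rt ∈ S).card : ℝ))) := mul_le_mul_of_nonneg_left havg hL0.le
    _ ≤ (P.L : ℝ) * (((P.L : ℝ) ^ (P.d + 1))⁻¹ * (β * (P.L * (S.filter fun c' => c'.dir = c.dir).card))) := by
        gcongr
    _ = (P.L : ℝ) * ((P.L : ℝ) ^ P.d)⁻¹ * (S.filter fun c' => c'.dir = c.dir).card * β := by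
        have hLd : ((P.L : ℝ) ^ (P.d + 1)) ≠ 0 := by positivity
        field_simp
        ring

/-- **(t) ON THE READERS OF A FINE BOND: `θ₀ = 2·L^{1−d}`** — for `w` vanishing off a finite set `S` of level-`j` bonds all having the site `β` among their endpoints (the level readers of
a fine bond inside `Bʲ(β)` are such), `‖w‖ ≤ β′` on `S`: `‖L·(Qw)(c)‖ ≤ 2·L·L^{−d}·β′`. [cite: Balaban1985Averaging, (142) p.39, (154) p.41] -/
theorem norm_tube_le_of_endpoint (hj : j + 1 ≤ P.m + P.K) (β : Site P j) (S : Finset (PBond P j)) (hS : ∀ c' ∈ S, c'.src = β ∨ c'.tgt = β)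
    (w : VecField P j V) (hw : ∀ c', c' ∉ S → w c' = 0) {β' : ℝ} (hβ' : 0 ≤ β') (hwβ : ∀ c' ∈ S, ‖w c'‖ ≤ β') (c : PBond P (j + 1)) :
    ‖(P.L : ℝ) • bondAvg w c‖ ≤ 2 * (P.L : ℝ) * ((P.L : ℝ) ^ P.d)⁻¹ * β' := by
  have h := norm_tube_le_of_vanish hj S w hw hβ' hwβ c
  have h2 : ((S.filter fun c' => c'.dir = c.dir).card : ℝ) ≤ 2 := by exact_mod_cast card_filter_endpoint_dir_le_two β c.dir S hS
  have hL0 : (0 : ℝ) ≤ (P.L : ℝ) * ((P.L : ℝ) ^ P.d)⁻¹ := by positivity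
  calc _ ≤ (P.L : ℝ) * ((P.L : ℝ) ^ P.d)⁻¹ * (S.filter fun c' => c'.dir = c.dir).card * β' := h
    _ ≤ (P.L : ℝ) * ((P.L : ℝ) ^ P.d)⁻¹ * 2 * β' := by gcongr
    _ = 2 * (P.L : ℝ) * ((P.L : ℝ) ^ P.d)⁻¹ * β' := by ring

end Readers

/-! ## §4 The tube as a continuous ℂ-linear map -/

section CLM

variable {j : ℕ} {V : Type*} [NormedAddCommGroup V] [NormedSpace ℂ V]

/-- **`L·Q` IS A CONTINUOUS ℂ-LINEAR MAP** on level-`j` fields with values in a finite-dimensional complex normed space (the `T_m` of ✓`ChartKernelTower.tower_deriv_recursion`;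
the real structure is the restriction of the complex one). [cite: Balaban1984PropagatorsI, (1.11) p.19] -/
theorem exists_tubeCLM [FiniteDimensional ℂ V] : ∃ T : (PBond P j → V) →L[ℂ] (PBond P (j + 1) → V), ∀ (w : PBond P j → V) (c : PBond P (j + 1)),
    T w c = (P.L : ℂ) • ((((P.L : ℂ) ^ (P.d + 1))⁻¹) • ∑ r : Fin P.d → Fin P.L, segSum w (Site.blockSite c.src r) c.dir P.L) := by
  let Tl : (PBond P j → V) →ₗ[ℂ] (PBond P (j + 1) → V) :=
    { toFun := fun w c => (P.L : ℂ) • ((((P.L : ℂ) ^ (P.d + 1))⁻¹) • ∑ r : Fin P.d → Fin P.L, segSum w (Site.blockSite c.src r) c.dir P.L)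
      map_add' := fun w w' => by
        funext c
        simp only [Pi.add_apply, segSum, Finset.sum_add_distrib, smul_add]
      map_smul' := fun z w => by
        funext c
        simp only [Pi.smul_apply, segSum, RingHom.id_apply, ← Finset.smul_sum, smul_comm z] }
  exact ⟨LinearMap.toContinuousLinearMap Tl, fun w c => rfl⟩

/-- The map of `exists_tubeCLM` IS `L·bondAvg` (the real scalar of (1.11) read as a complex one). [cite: Balaban1984PropagatorsI, (1.11) p.19] -/
theorem tubeCLM_formula_eq_smul_bondAvg (w : PBond P j → V) (c : PBond P (j + 1)) :
    (P.L : ℂ) • ((((P.L : ℂ) ^ (P.d + 1))⁻¹) • ∑ r : Fin P.d → Fin P.L, segSum w (Site.blockSite c.src r) c.dir P.L) = (P.L : ℝ) • bondAvg w c := by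
  unfold bondAvg
  rw [RCLike.real_smul_eq_coe_smul (K := ℂ), RCLike.real_smul_eq_coe_smul (K := ℂ)]
  push_cast
  rfl

end CLM

end Summit.QuantumFields.YangMills.Theorems.ChartKernelTube

end
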